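import Summits.QuantumFields.QCD.Theses.NestedDissectionSea
import Summits.QuantumFields.QCD.Theorems.NestedDissectionSeaKineticEdge
import Literature.MathematicalPhysics.QuantumLattice.TopologicalCriticalMass

/-!
# Crux `EarlyCrosserLaw` (stmt-QuantumFields-13995), line `cells-inherit-torus-extinction` — the kinetic edge for
# box-supported QUASIMODES of the torus Wilson–Dirac operator (deterministic layer of the hardest stub S2′)

Sorry-free, standard axioms. The quasimode analogue of the landed zero-mode kinetic edge
`KineticEdge.kineticEdge_zeroMode` (route support `KineticEdge`, stmt-QuantumFields-13899): if a NON-ZERO field `v` supported in the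
open box of corner `x` and sides `s ≤ N`, extended by zero, is a quasimode of the torus operator `D_W(U, μ′, 1)` at level `η ≥ 0`,
`Σ_p ‖(D_W v̂) p‖² ≤ η² Σ_q ‖v q‖²`, then `μ′ + Σ_i (1 − cos(π/s_i)) ≤ η`. Proof: the numerical range on box-supported fields
(`KineticEdge.re_quadForm_wilsonDirac_ge_box`: `(μ′ + 4 − Σ cos(π/s_i)) ‖v̂‖² ≤ Re⟨v̂, D_W v̂⟩`) and Cauchy–Schwarz
`Re⟨v̂, D_W v̂⟩ ≤ ‖v̂‖ ‖D_W v̂‖ ≤ η ‖v̂‖²`. Consequence for S2′ (`stub_torusLocalExtinctionOnBranch` of the line skeleton): its charged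
event at `(μ′, box)` is EMPTY unless `Σ_i(1 − cos(π/s_i)) ≤ η − μ′ ≤ |m_f(k)| + c·a_k m_f/Z_m` — the kinematic flag of the v4 skeleton
in its natural quasimode form (the skeleton carries the slightly stronger crossing form, supplied by `kineticEdge_zeroMode`).
[folklore]
-/

noncomputable section

open Matrix Complex Filter MeasureTheory
open Literature.MathematicalPhysics.QuantumLattice Literature.MathematicalPhysics.QuantumFieldTheory
  Literature.Probability.LatticeModels

namespace Summit.QuantumFields.QCD.Cruxes.EarlyCrosserLaw.CellsInheritTorusExtinction

open scoped ComplexConjugate BigOperators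

/-- **Kinetic edge for box-supported quasimodes of the torus operator.** For every `SU(3)` field `U` on `(ℤ/N)⁴`, bare mass
`μ′`, box `(x, s)` with `s_i ≤ N`, level `η ≥ 0` and NON-ZERO `v` on the box: if the zero-extension `v̂` satisfies
`Σ_p ‖(D_W(U,μ′,1) v̂) p‖² ≤ η² Σ_q ‖v q‖²` then `μ′ + Σ_i (1 − cos(π/s_i)) ≤ η`. [folklore] -/
theorem quasimode_kineticEdge {N : ℕ} [NeZero N] (U : GaugeConfig 4 N SU3) (μ' : ℝ) (x : TorusSite 4 N)
    (s : Fin 4 → ℕ) (hs : ∀ i, s i ≤ N) {η : ℝ} (hη : 0 ≤ η) (v : {p // wilsonBox x s p} → ℂ) (hv : v ≠ 0)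
    (hq : ∑ p, ‖(wilsonDirac (fundamentalRep (Fin 3)) U μ' 1 *ᵥ
        fun q => if h : wilsonBox x s q then v ⟨q, h⟩ else 0) p‖ ^ 2 ≤ η ^ 2 * ∑ q, ‖v q‖ ^ 2) :
    μ' + ∑ i, (1 - Real.cos (Real.pi / s i)) ≤ η := by
  classical
  set D := wilsonDirac (fundamentalRep (Fin 3)) U μ' 1 with hD
  set w : TorusSite 4 N × Fin 3 × Fin 4 → ℂ := fun q => if h : wilsonBox x s q then v ⟨q, h⟩ else 0 with hw
  have hwp : ∀ a : {p // wilsonBox x s p}, w a = v a := fun a => by simp [hw, a.2]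
  have hwn : ∀ i, ¬ wilsonBox x s i → w i = 0 := fun i hi => by simp [hw, hi]
  have hsupp : ∀ i : TorusSite 4 N × Fin 3 × Fin 4, ¬ siteBox x s i.1 → w i = 0 :=
    fun i hi => hwn i (by rwa [wilsonBox_iff])
  -- `Σ ‖w‖² = Σ ‖v‖²`
  have hnorm : ∑ i, ‖w i‖ ^ 2 = ∑ q, ‖v q‖ ^ 2 := by
    have : ∀ i, ‖w i‖ ^ 2 = (if h : wilsonBox x s i then ‖v ⟨i, h⟩‖ ^ 2 else 0) := by
      intro i
      by_cases hi : wilsonBox x s i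
      · rw [dif_pos hi, hwp ⟨i, hi⟩]
      · rw [dif_neg hi, hwn i hi, norm_zero]; ring
    simp_rw [this]
    exact Summit.QuantumFields.QCD.Theorems.KineticEdge.sum_dite_subtype (wilsonBox x s) (fun q => ‖v q‖ ^ 2)
  set n2 := ∑ q, ‖v q‖ ^ 2 with hn2
  have hn2_pos : 0 < n2 := by
    obtain ⟨a, ha⟩ : ∃ a, v a ≠ 0 := by
      by_contra h
      push Not at h
      exact hv (funext h)
    exact lt_of_lt_of_le (by positivity : 0 < ‖v a‖ ^ 2)
      (Finset.single_le_sum (f := fun b => ‖v b‖ ^ 2) (fun b _ => by positivity) (Finset.mem_univ a))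
  -- numerical range on box-supported fields
  have hco := Summit.QuantumFields.QCD.Theorems.KineticEdge.re_quadForm_wilsonDirac_ge_box
    (fundamentalRep (Fin 3)) fundamentalRep_mem_unitaryGroup U μ' x s hs w hsupp
  rw [hnorm] at hco
  -- Cauchy–Schwarz: `Re⟨w, D w⟩ ≤ A := Σ ‖w i‖ ‖(D w) i‖`, `A² ≤ ‖w‖² ‖D w‖² ≤ η² n2²`
  set A := ∑ i, ‖w i‖ * ‖(D *ᵥ w) i‖ with hA
  have hA1 : (∑ i, conj (w i) * (D *ᵥ w) i).re ≤ A := by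
    refine (Complex.re_le_norm _).trans ((norm_sum_le _ _).trans (le_of_eq ?_))
    simp [A]
  have hA0 : 0 ≤ A := Finset.sum_nonneg fun i _ => by positivity
  have hA2 : A ^ 2 ≤ (∑ i, ‖w i‖ ^ 2) * ∑ i, ‖(D *ᵥ w) i‖ ^ 2 := Finset.sum_mul_sq_le_sq_mul_sq _ _ _
  rw [hnorm] at hA2
  have hA3 : A ^ 2 ≤ (η * n2) ^ 2 := by
    calc A ^ 2 ≤ n2 * ∑ i, ‖(D *ᵥ w) i‖ ^ 2 := hA2
      _ ≤ n2 * (η ^ 2 * n2) := mul_le_mul_of_nonneg_left hq hn2_pos.le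
      _ = (η * n2) ^ 2 := by ring
  have hA4 : A ≤ η * n2 := by
    have hηn : 0 ≤ η * n2 := mul_nonneg hη hn2_pos.le
    nlinarith [hA3, hA0, hηn]
  have hle : (μ' + 4 - ∑ ν, Real.cos (Real.pi / s ν)) * n2 ≤ η * n2 := (hco.trans hA1).trans hA4
  have hμ : μ' + 4 - ∑ ν, Real.cos (Real.pi / s ν) ≤ η := le_of_mul_le_mul_right hle hn2_pos
  rw [Summit.QuantumFields.QCD.Theorems.KineticEdge.sum_one_sub_cos]
  linarith

end Summit.QuantumFields.QCD.Cruxes.EarlyCrosserLaw.CellsInheritTorusExtinction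

end
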